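import Summits.QuantumFields.YangMills.Theorems.BalabanUVNodesN07ShearSizeTopBox
import Literature.MathematicalPhysics.QuantumFieldTheory.Balaban1983to89.BlockAveragingPlaquetteBound
import Literature.MathematicalPhysics.QuantumFieldTheory.Balaban1983to89.T4ReflectionConeSharp
import Literature.MathematicalPhysics.QuantumFieldTheory.Balaban1983to89.Node00.TorusCoverLevels
import HarnessLib

/-!
# N07 [B11] (= [15] = [Balaban1985Variational]) Sect. F — [3] PROP. 1 FOR THE (0.4) AVERAGING OF RECORD WITH THE **TIGHT HULL**: the coarse plaquette of `Ū = M(U)` is small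
# as soon as the plaquettes of `U` with all four corners in the FOUR CORNER BLOCKS of the coarse plaquette are small — print's «it is a local result; the bound depends on bounds
# for V(∂p) − 1 on Δ(p′)» (p. 25) with `Δ(p′)` = the union of the blocks of the vertices of `p′`, for Bałaban's (0.3)–(0.4) average on the torus (crude constant)

Cell `pub-ymgap`, seat `pub-ymgap-dag-n07-e` g24 (FAN-OUT §N07 row s3; LANE OWNER of the K0 road), MODULE 68 — the analytic letter of the chart lane's item (C1a) (OUTWARD-MEET-EDITION-SPEC
§10: the `δ̂`-supplier of MODULE 62 `…N07NormalisationTopRows` needs «(7) for V» on the WHOLE top box, and on the dent ∕ ring outside `Ω_j` the level-`j` plaquettes of `M^j U` are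
ONCE-AVERAGED level-`(j−1)` data, [15] (13)).  `--kind proof --supports stmt-QuantumFields-20541 --as helper` (K0⁷); count-neutral; def-free.
[3] = [Balaban1985Averaging]; [I] = [Balaban1987RG1]; [15] = [Balaban1985Variational]; [4] = [Balaban1984PropagatorsII].

WHY A NEW LOCALITY.  The tree holds [3] Prop. 1 for the averaging of record `blockAvg expMeanLogSU` GLOBALLY (`BlockAveragingPlaquetteBound.dist1_plaqHol_avgFun_lt`, `PlaqSmall a U` on the
whole torus; dag-n21-c's sharp `BlockAveragingEMLProp2`) and LOCALLY with a WALK HULL of radius `(d+3)L + 2` ∕ `(d+4)L + 2` fine sites around the block centre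
(`N20LCSAvgDomination.dist1_plaqHol_avgFun_le_loc`, `N21LocalAveragedRegularity.dist1_plaqHol_avgFun_lt_sharp_of_plaqSmallOn`) — several blocks BEYOND the four blocks the average actually
reads (two-block locality `T4ReflectionConeSharp.avgFun_congr₂`).  For (C1a) the hull must NOT leave the four corner blocks: a dent plaquette of the chart's top box sits next to `Ω_j^{(j)}`,
under whose blocks the level-`(j−1)` averages are NOT data (the record leaves `M^{j−1}U` free under `Ω_j`), so a walk hull reaching into them would mix an ε-type letter into `δ̂` (not
budgetable, SPEC §10).  THIS FILE proves the tight-hull form by an AXIAL EXTENSION instead of re-running the Stokes calculus: put `U` in pv26's axial gauge `h` on the `2L`-box `R` of the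
four corner blocks (`T4AxialGaugeSmallField.axialGauge`; every box bond of `U^h` is within `(d−1)(2L−1)·a` of `1` by the torus non-abelian Poincaré lemma
`dist1_gaugeAct_axialGauge_le_of_mem_boxBonds`), extend `U^h|_R` by `1` off the box bonds — a configuration `U♭` on the WHOLE torus all of whose plaquettes are within `4(d−1)(2L−1)·a` of `1`
— apply the GLOBAL crude Prop. 1 to `U♭`, and come back: `Ū♭(∂p′) = \overline{U^h}(∂p′)` by two-block locality (the bonds with both ends in the blocks of `p′`'s vertices are box bonds:
§1's blow-down dictionary + dag-n07-w6's `mem_boxBonds_of_ends_mem_box`), `\overline{U^h} = (Ū)^{h∘emb}` by covariance (`avgFun_covariant`), and `|·(∂p′) − 1|` is gauge invariant.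

WHAT IS PROVED (sorry-free; no definition; axioms standard; generic `P : Params`, level `m` in the standing range `m + 1 ≤ P.m + P.K`, group `SU(n)`).
§1 `castSite_eq_coverAt` (`rfl` dictionary) · ★ `mem_blowDown_of_blockOf_mem_box` (converse of dag-n07-w6's `blockOf_mem_box_of_mem_blowDown`: a fine site whose BLOCK lies in the coarse
integer box `[lo′, hi′]` lies in the blow-down box `[L·lo′, L·hi′ + (L−1)]` — no non-wrapping needed) · `corner_mem_box₂` (the four vertices of `p′ = ⟨castSite x, μ, ν⟩` lie in `castSite '' [x, x + e_μ + e_ν]`).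
§2 `dist1_plaqHol_le_of_bonds` (a plaquette of bond variables each within `τ` of `1` is within `4τ` of `1`) · ★★ `dist1_plaqHol_extendOne_gaugeAct_axialGauge_le` (every plaquette of the axial
extension `U♭` is within `4(d−1)·n·a` of `1`) · `dist1_plaqHol_gaugeAct_eq` (`|U^u(∂q) − 1| = |U(∂q) − 1|`, re-derived).
§3 ★★★ `dist1_plaqHol_avgFun_lt_of_cornerBlocks`: for `0 < a`, `2L < N_m` (the `2L`-box does not wrap) and the crude guard `(((d+2)L)²∕4)·((4(d−1)(2L−1) + 1)·a) < δ_n`: if every level-`m`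
plaquette with lower corner `z`, `L·x ≤ z`, `z + e_κ + e_λ ≤ L·(x + e_μ + e_ν) + (L−1)` (all four corners in the four corner blocks of `p′ = ⟨castSite x, μ, ν⟩`) is within `a` of `1`, then
`|Ū(∂p′) − 1| < (L² + 6((d+2)L)²)·(4(d−1)(2L−1) + 1)·a` for `Ū = avgFun expMeanLogSU U` — the averaging of record (`Node00.avOfRecord = blockAvg expMeanLogSU`); ★★★ `dist1_plaqHol_avOfRecord_lt_of_cornerBlocks`
(the same read on `(avOfRecord F N K m).avg`).

HONEST SCOPE.  Count-neutral lattice gauge algebra on ONE configuration; a CRUDE constant (the printed `L²α₀ + C₀(L²α₀)²` of (51) is not reproduced — the axial detour costs a factor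
`≈ 4(d−1)(2L−1)`; enough for (C1a), whose letter only has to be δ-LINEAR); nothing of [15]∕[3]∕[4] beyond the cited bookkeeping asserted; (C1a) itself (which top-box plaquettes are data,
which are averaged data) is the NEXT module; HS3NORM ∕ HCHART-MEET-NORM ∕ `δ̂` stay displayed; K0⁷ ∕ K1⁹ NOT closed; N07 NOT discharged; counts unmoved (typed 28∕28 · discharged 5∕27); one finite
𝕋⁴ programme at fixed ε — the route closes the conditional finite-𝕋⁴ rung `BalabanLadder.UV` ONLY; the YM mass gap (Clay) is NOT proved by any of this; nothing continuum ∕ ℝ⁴ ∕ OS.  No `sorry`,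
no `def`, no `instance`, no `notation`.  RELATED, NOT DUPLICATED (BY NAME): `BlockAveragingPlaquetteBound.dist1_plaqHol_avgFun_lt` (global), `N20LCSAvgDomination.dist1_plaqHol_avgFun_le_loc` ∕
`N21LocalAveragedRegularity.dist1_plaqHol_avgFun_lt_sharp_of_plaqSmallOn` (walk hulls), `T4ReflectionConeSharp.avgFun_congr₂`, `BlockAveraging.avgFun_covariant`,
`T4AxialGaugeSmallField.dist1_gaugeAct_axialGauge_le_of_mem_boxBonds`, dag-n07-w6 `N07ShearSizeTopBox.mem_boxBonds_of_ends_mem_box` ∕ `N07DataDownTheTowerBlowDown.blockOf_mem_box_of_mem_blowDown`,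
n07-e MODULE 38 `TorusCoverLevels.blockOf_coverAt ∕ coverAt_add_period ∕ coverAt_valLift`.

References: [3] Prop. 1 (51) pp. 25–26 («it is a local result … on Δ(p′)»), (42)–(44) pp. 23–24; [I] (0.3)–(0.4) p. 253; [15] (13) p. 280, (147) p. 301, (160) p. 303; [4] (1.7) p. 18.
-/

set_option autoImplicit false

noncomputable section
open scoped BigOperators Matrix.Norms.L2Operator

namespace Summit.QuantumFields.YangMills.BalabanUVNodes.N07AveragedPlaquetteCornerBlocks

open Literature.MathematicalPhysics.QuantumFieldTheory.Balaban1983to89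
open Literature.MathematicalPhysics.QuantumFieldTheory.Balaban1983to89.Node00
open T4Continuum
open T4AxialGaugeSmallField (castSite castSite_apply castSite_add_e boxBonds boxPlaqs axialGauge dist1_gaugeAct_axialGauge_le_of_mem_boxBonds)
open B7Prop1Explicit (e e_apply)
open GaugeField (gaugeAct plaqHol)
open ExpMeanLog (expMeanLogSU deltaSU)
open BlockAveraging (avgFun avgFun_covariant blockAvg_avg)
open Summit.QuantumFields.YangMills.BalabanUVNodes.N07ShearSizeTopBox (mem_boxBonds_of_ends_mem_box)
open Literature.MathematicalPhysics.QuantumLattice (blockMap)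

variable {P : Params} {m : ℕ}

/-! ## §1  The blow-down dictionary: a fine site whose block lies in a coarse box lies in the blow-down box -/

section Geometry

/-- pv26's `castSite` IS MODULE 38's level cover `coverAt` (`rfl`). [cite: Balaban1987RG1, (0.1) p.251 (bookkeeping)] -/
theorem castSite_eq_coverAt (j : ℕ) (z : Fin P.d → ℤ) : (castSite z : Site P j) = coverAt P j z := rfl

/-- ★ **A FINE SITE WHOSE BLOCK LIES IN THE COARSE BOX `[lo′, hi′]` LIES IN THE BLOW-DOWN BOX `[L·lo′, L·hi′ + (L − 1)]`** (standing range; no non-wrapping hypothesis: the label of the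
block is corrected by a period of `T^{(m+1)}`, i.e. the fine label by a period of `T^{(m)}`, `N_m = N_{m+1}·L`). Converse of dag-n07-w6's `blockOf_mem_box_of_mem_blowDown`.
[cite: Balaban1987RG1, (0.1)–(0.3) pp.251–252; Balaban1985RegularSpaces, p.98 («□_j is a sum of the big blocks»)] -/
theorem mem_blowDown_of_blockOf_mem_box (hm : m + 1 ≤ P.m + P.K) {lo' hi' : Fin P.d → ℤ} {y : Site P m}
    (hy : blockOf y ∈ (castSite '' Set.Icc lo' hi' : Set (Site P (m + 1)))) :
    y ∈ (castSite '' Set.Icc (fun i => (P.L : ℤ) * lo' i) (fun i => (P.L : ℤ) * hi' i + ((P.L : ℤ) - 1)) : Set (Site P m)) := by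
  obtain ⟨t, ⟨htlo, hthi⟩, ht⟩ := hy
  have hL0 : (0 : ℤ) < P.L := by exact_mod_cast P.L_pos
  -- the label vector of `y` and its block label
  set s : Fin P.d → ℤ := fun μ => ((y μ).val : ℤ) with hs
  have hys : (castSite s : Site P m) = y := coverAt_valLift m y
  have hblk : blockOf y = (castSite (blockMap P.L s) : Site P (m + 1)) := by
    rw [← hys]; exact blockOf_coverAt hm s
  -- `⌊s∕L⌋ ≡ t` modulo `N_{m+1}`: correct `s` by the corresponding period of `T^{(m)}`
  have hdvd : ∀ μ, ((P.sitesPerDir (m + 1) : ℕ) : ℤ) ∣ t μ - s μ / (P.L : ℤ) := by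
    have := (coverAt_eq_coverAt_iff (P := P) (m + 1) (blockMap P.L s) t).1 (hblk.symm.trans ht.symm)
    intro μ
    have h := this μ
    simpa [blockMap] using h
  choose q hq using hdvd
  set s' : Fin P.d → ℤ := s + fun μ => ((P.sitesPerDir m : ℕ) : ℤ) * q μ with hs'
  have hNm : ((P.sitesPerDir m : ℕ) : ℤ) = ((P.sitesPerDir (m + 1) : ℕ) : ℤ) * (P.L : ℤ) := by
    rw [P.sitesPerDir_eq_mul_succ hm]; push_cast; ring
  have hdiv : ∀ μ, s' μ / (P.L : ℤ) = t μ := by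
    intro μ
    have e1 : s' μ = s μ + (((P.sitesPerDir (m + 1) : ℕ) : ℤ) * q μ) * (P.L : ℤ) := by
      simp only [hs', Pi.add_apply, hNm]; ring
    rw [e1, Int.add_mul_ediv_right _ _ hL0.ne']
    have := hq μ
    linarith
  refine ⟨s', ⟨fun μ => ?_, fun μ => ?_⟩, ?_⟩
  · -- `L·lo′ ≤ s′`: from `L·⌊s′∕L⌋ ≤ s′` and `lo′ ≤ t = ⌊s′∕L⌋`
    have h1 := Int.ediv_mul_le (s' μ) hL0.ne'
    rw [hdiv μ] at h1
    have h2 : (P.L : ℤ) * lo' μ ≤ (P.L : ℤ) * t μ := mul_le_mul_of_nonneg_left (htlo μ) hL0.le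
    simp only
    linarith
  · -- `s′ ≤ L·hi′ + (L−1)`: from `s′ < L·(⌊s′∕L⌋ + 1)`
    have h1 := Int.lt_ediv_add_one_mul_self (s' μ) hL0
    rw [hdiv μ] at h1
    have h2 : (P.L : ℤ) * t μ ≤ (P.L : ℤ) * hi' μ := mul_le_mul_of_nonneg_left (hthi μ) hL0.le
    simp only
    linarith
  · -- the corrected label still names `y`
    rw [← hys, castSite_eq_coverAt, castSite_eq_coverAt, hs']
    exact coverAt_add_period m s q

/-- The four vertices of the coarse plaquette `⟨castSite x, μ, ν⟩` lie in `castSite '' [x, x + e_μ + e_ν]`. [cite: Balaban1985Averaging, p.25 («Δ(p′)»; bookkeeping)] -/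
theorem corner_mem_box₂ {j : ℕ} (x : Fin P.d → ℤ) {μ ν : Fin P.d} (y : Site P j)
    (hy : y = castSite x ∨ y = (castSite x : Site P j).shift μ ∨ y = (castSite x : Site P j).shift ν ∨ y = ((castSite x : Site P j).shift μ).shift ν) :
    y ∈ (castSite '' Set.Icc x (x + e μ + e ν) : Set (Site P j)) := by
  have h0 : ∀ κ, (0 : ℤ) ≤ e μ κ := fun κ => by rw [e_apply]; split_ifs <;> norm_num
  have h1 : ∀ κ, (0 : ℤ) ≤ e ν κ := fun κ => by rw [e_apply]; split_ifs <;> norm_num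
  rcases hy with rfl | rfl | rfl | rfl
  · exact ⟨x, ⟨le_rfl, fun κ => by simp only [Pi.add_apply]; linarith [h0 κ, h1 κ]⟩, rfl⟩
  · exact ⟨x + e μ, ⟨fun κ => by simp only [Pi.add_apply]; linarith [h0 κ], fun κ => by simp only [Pi.add_apply]; linarith [h1 κ]⟩, castSite_add_e x μ⟩
  · exact ⟨x + e ν, ⟨fun κ => by simp only [Pi.add_apply]; linarith [h1 κ], fun κ => by simp only [Pi.add_apply]; linarith [h0 κ]⟩, castSite_add_e x ν⟩
  · refine ⟨x + e μ + e ν, ⟨fun κ => by simp only [Pi.add_apply]; linarith [h0 κ, h1 κ], le_rfl⟩, ?_⟩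
    rw [castSite_add_e, castSite_add_e]

end Geometry

/-! ## §2  The axial extension `U♭`: `U^h` on the box bonds, `1` elsewhere — plaquette-small on the whole torus -/

section Extension

variable {G : Type*} [GaugeGroup G]

/-- A plaquette of bond variables each within `τ` of `1` is within `4τ` of `1` (`|gh − 1| ≤ |g − 1| + |h − 1|`, `|g⁻¹ − 1| = |g − 1|`). [cite: Balaban1985Averaging, (44) p.24 (bookkeeping)] -/
theorem dist1_plaqHol_le_of_bonds {j : ℕ} (U : GaugeField P j G) {τ : ℝ} (hU : ∀ b, dist1 (U b) ≤ τ) (q : Plaq P j) : dist1 (plaqHol U q) ≤ 4 * τ := by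
  unfold GaugeField.plaqHol
  have h1 := hU ⟨q.src, q.μ⟩
  have h2 := hU ⟨q.src.shift q.μ, q.ν⟩
  have h3 : dist1 (U ⟨q.src.shift q.ν, q.μ⟩)⁻¹ ≤ τ := by rw [GaugeGroup.dist1_inv]; exact hU _
  have h4 : dist1 (U ⟨q.src, q.ν⟩)⁻¹ ≤ τ := by rw [GaugeGroup.dist1_inv]; exact hU _
  calc dist1 (U ⟨q.src, q.μ⟩ * U ⟨q.src.shift q.μ, q.ν⟩ * (U ⟨q.src.shift q.ν, q.μ⟩)⁻¹ * (U ⟨q.src, q.ν⟩)⁻¹)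
      ≤ dist1 (U ⟨q.src, q.μ⟩ * U ⟨q.src.shift q.μ, q.ν⟩ * (U ⟨q.src.shift q.ν, q.μ⟩)⁻¹) + dist1 (U ⟨q.src, q.ν⟩)⁻¹ := GaugeGroup.dist1_mul_le _ _
    _ ≤ dist1 (U ⟨q.src, q.μ⟩ * U ⟨q.src.shift q.μ, q.ν⟩) + dist1 (U ⟨q.src.shift q.ν, q.μ⟩)⁻¹ + dist1 (U ⟨q.src, q.ν⟩)⁻¹ := by
        gcongr; exact GaugeGroup.dist1_mul_le _ _
    _ ≤ dist1 (U ⟨q.src, q.μ⟩) + dist1 (U ⟨q.src.shift q.μ, q.ν⟩) + dist1 (U ⟨q.src.shift q.ν, q.μ⟩)⁻¹ + dist1 (U ⟨q.src, q.ν⟩)⁻¹ := by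
        gcongr; exact GaugeGroup.dist1_mul_le _ _
    _ ≤ τ + τ + τ + τ := by gcongr
    _ = 4 * τ := by ring

open scoped Classical in
/-- ★★ **THE AXIAL EXTENSION IS PLAQUETTE-SMALL ON THE WHOLE TORUS.**  On a box `[lo, hi]` with `n + 1` labels per direction (`hi ≤ lo + n`, `n < N_m`), if the plaquettes of `U` based in
the box are `< a` (`0 ≤ a`), then the configuration `U♭ b := if b ∈ boxBonds lo hi then U^h b else 1`, `h = axialGauge U lo hi`, has EVERY plaquette within `4(d−1)·n·a` of `1` — each box bond of
`U^h` is within `(d−1)·n·a` (pv26), the others are `1`. [cite: Balaban1984PropagatorsII, (1.7) p.18; Balaban1985Variational, (147) p.301, (160) p.303] -/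
theorem dist1_plaqHol_extendOne_gaugeAct_axialGauge_le {j : ℕ} (U : GaugeField P j G) {lo hi : Fin P.d → ℤ} {a : ℝ} (ha : 0 ≤ a)
    (hU : PlaqSmallOn (boxPlaqs lo hi) a U) {n : ℕ} (hn : ∀ κ, hi κ ≤ lo κ + n) (hnN : n < P.sitesPerDir j) (q : Plaq P j) :
    dist1 (plaqHol (fun b => if b ∈ boxBonds lo hi then gaugeAct (axialGauge U lo hi) U b else 1) q) ≤ 4 * ((((P.d - 1 : ℕ) : ℝ)) * n * a) := by
  refine dist1_plaqHol_le_of_bonds _ (fun b => ?_) q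
  by_cases hb : b ∈ boxBonds lo hi
  · rw [if_pos hb]
    exact dist1_gaugeAct_axialGauge_le_of_mem_boxBonds U subset_rfl hU ha hn hnN hb
  · rw [if_neg hb, GaugeGroup.dist1_one]
    have : (0 : ℝ) ≤ ((P.d - 1 : ℕ) : ℝ) * n * a := by positivity
    exact this

/-- `|U^u(∂q) − 1| = |U(∂q) − 1|`: the four gauge factors telescope to a conjugation (re-derived; the tree's `T4ReTrLipUnitary.plaqHol_gaugeAct` ∕ `B15Prop1Carrier.dist1_plaqHol_gaugeAct` are
outside this file's import closure). [cite: Balaban1985Averaging, (9) p.19] -/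
theorem dist1_plaqHol_gaugeAct_eq {j : ℕ} (u : GaugeTransf P j G) (U : GaugeField P j G) (q : Plaq P j) :
    dist1 (plaqHol (gaugeAct u U) q) = dist1 (plaqHol U q) := by
  have hcomm : (q.src.shift q.ν).shift q.μ = (q.src.shift q.μ).shift q.ν := by
    funext κ
    by_cases h1 : κ = q.μ
    · subst h1
      by_cases h2 : q.μ = q.ν
      · rw [h2]
      · simp [Site.shift, Function.update_self, Function.update_of_ne h2]
    · by_cases h2 : κ = q.ν
      · subst h2
        simp [Site.shift, Function.update_self, Function.update_of_ne h1]
      · simp [Site.shift, Function.update_of_ne h1, Function.update_of_ne h2]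
  have : plaqHol (gaugeAct u U) q = u q.src * plaqHol U q * (u q.src)⁻¹ := by
    simp only [GaugeField.plaqHol, GaugeField.gaugeAct, PBond.tgt, hcomm]
    group
  rw [this, GaugeGroup.dist1_conj]

end Extension

/-! ## §3  [3] Prop. 1 with the tight hull for the (0.4) averaging of record -/

section Main

variable {n : Type*} [Fintype n] [DecidableEq n] [Nonempty n]

open scoped Classical in
/-- ★★★ **[3] PROP. 1 FOR THE (0.4) AVERAGING OF RECORD, TIGHT HULL** (crude constant): standing range `m + 1 ≤ P.m + P.K`, `0 < a`, the `2L`-box does not wrap (`2L < N_m`), and the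
guard `(((d+2)L)²∕4)·((4(d−1)(2L−1) + 1)·a) < δ_n`.  If every level-`m` plaquette based in the blow-down box `[L·x, L·(x + e_μ + e_ν) + (L−1)]` of the four corner blocks of the coarse
plaquette `p′ = ⟨castSite x, μ, ν⟩` is within `a` of `1`, then `|Ū(∂p′) − 1| < (L² + 6((d+2)L)²)·((4(d−1)(2L−1) + 1)·a)`, `Ū = avgFun expMeanLogSU U` — print's «it is a local result; the
bound above depends on bounds for V(∂p) − 1 on Δ(p′)» with `Δ(p′)` exactly the blocks of the vertices of `p′`.  Proof: axial gauge `h` on the box (§2's `U♭` is globally plaquette-small),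
the GLOBAL crude Prop. 1 for `U♭`, two-block locality `Ū♭(c) = \overline{U^h}(c)` on the four bonds of `p′` (§1), covariance `\overline{U^h} = Ū^{h∘emb}` and gauge invariance of `|·(∂p′) − 1|`.
[cite: Balaban1985Averaging, Prop. 1 (51) pp.25–26, (42)–(44) pp.23–24; Balaban1987RG1, (0.3)–(0.4) p.253; Balaban1985Variational, (13) p.280, (147) p.301] -/
theorem dist1_plaqHol_avgFun_lt_of_cornerBlocks (hm : m + 1 ≤ P.m + P.K) {a : ℝ} (ha : 0 < a) (hN : 2 * P.L < P.sitesPerDir m)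
    (ht : ((((P.d + 2) * P.L : ℕ) : ℝ) ^ 2 / 4) * ((4 * ((((P.d - 1 : ℕ) : ℝ)) * ((2 * P.L - 1 : ℕ) : ℝ)) + 1) * a) < deltaSU n)
    (U : GaugeField P m (Matrix.specialUnitaryGroup n ℂ)) (x : Fin P.d → ℤ) {μ ν : Fin P.d} (hμν : μ < ν)
    (hU : PlaqSmallOn (boxPlaqs (fun i => (P.L : ℤ) * x i) (fun i => (P.L : ℤ) * (x + e μ + e ν) i + ((P.L : ℤ) - 1))) a U) :
    dist1 (plaqHol (avgFun (expMeanLogSU (n := n)) U) ⟨castSite x, μ, ν, hμν⟩) <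
      ((P.L : ℝ) ^ 2 + 6 * (((P.d + 2) * P.L : ℕ) : ℝ) ^ 2) * ((4 * ((((P.d - 1 : ℕ) : ℝ)) * ((2 * P.L - 1 : ℕ) : ℝ)) + 1) * a) := by
  -- the box of the four corner blocks and its axial gauge
  set lo : Fin P.d → ℤ := fun i => (P.L : ℤ) * x i with hlo
  set hi : Fin P.d → ℤ := fun i => (P.L : ℤ) * (x + e μ + e ν) i + ((P.L : ℤ) - 1) with hhi
  set h : GaugeTransf P m (Matrix.specialUnitaryGroup n ℂ) := axialGauge U lo hi with hh
  set Uf : GaugeField P m (Matrix.specialUnitaryGroup n ℂ) := fun b => if b ∈ boxBonds lo hi then gaugeAct h U b else 1 with hUf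
  have hL1 : (1 : ℤ) ≤ P.L := by exact_mod_cast P.L_pos
  have hne : μ ≠ ν := hμν.ne
  -- the box has `2L` labels in the directions `μ, ν` and `L` in the others: `hi ≤ lo + (2L − 1)`
  have hn : ∀ κ, hi κ ≤ lo κ + ((2 * P.L - 1 : ℕ) : ℤ) := by
    intro κ
    have hcast : ((2 * P.L - 1 : ℕ) : ℤ) = 2 * (P.L : ℤ) - 1 := by
      have : 1 ≤ 2 * P.L := by have := P.L_pos; omega
      push_cast [Nat.cast_sub this]; ring
    simp only [hhi, hlo, Pi.add_apply, e_apply, hcast]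
    by_cases h1 : κ = μ
    · subst h1; rw [if_pos rfl, if_neg hne]; nlinarith
    · rw [if_neg h1]
      by_cases h2 : κ = ν
      · rw [if_pos h2]; nlinarith
      · rw [if_neg h2]; nlinarith
  have hnN : 2 * P.L - 1 < P.sitesPerDir m := by omega
  have hN' : ∀ κ, hi κ + 1 - lo κ < P.sitesPerDir m := by
    intro κ
    have := hn κ
    have hcast : ((2 * P.L - 1 : ℕ) : ℤ) + 1 + 1 ≤ (P.sitesPerDir m : ℤ) := by
      have : 1 ≤ 2 * P.L := by have := P.L_pos; omega
      push_cast [Nat.cast_sub this]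
      have : ((2 * P.L : ℕ) : ℤ) < (P.sitesPerDir m : ℤ) := by exact_mod_cast hN
      push_cast at this
      linarith
    linarith
  -- (i) the axial extension is plaquette-small on the WHOLE torus
  set τ : ℝ := (((P.d - 1 : ℕ) : ℝ)) * ((2 * P.L - 1 : ℕ) : ℝ) * a with hτ
  have hτ0 : 0 ≤ τ := by positivity
  have hflat : PlaqSmall ((4 * ((((P.d - 1 : ℕ) : ℝ)) * ((2 * P.L - 1 : ℕ) : ℝ)) + 1) * a) Uf := by
    intro q
    have hq := dist1_plaqHol_extendOne_gaugeAct_axialGauge_le U ha.le hU hn hnN q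
    have : 4 * ((((P.d - 1 : ℕ) : ℝ)) * ((2 * P.L - 1 : ℕ) : ℝ) * a) < (4 * ((((P.d - 1 : ℕ) : ℝ)) * ((2 * P.L - 1 : ℕ) : ℝ)) + 1) * a := by
      nlinarith
    exact lt_of_le_of_lt (by simpa [hUf] using hq) this
  -- (ii) the GLOBAL crude Prop. 1 for the extension
  have hglob := BlockAveragingPlaquetteBound.dist1_plaqHol_avgFun_lt (n := n) hm (by positivity) hflat ht ⟨castSite x, μ, ν, hμν⟩
  -- (iii) two-block locality: on the four bonds of `p′` the averages of `U♭` and of `U^h` agree (the bonds read are box bonds)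
  have hbox : ∀ c : PBond P (m + 1),
      (c.src = castSite x ∨ c.src = (castSite x : Site P (m + 1)).shift μ ∨ c.src = (castSite x : Site P (m + 1)).shift ν ∨
        c.src = ((castSite x : Site P (m + 1)).shift μ).shift ν) →
      (c.tgt = castSite x ∨ c.tgt = (castSite x : Site P (m + 1)).shift μ ∨ c.tgt = (castSite x : Site P (m + 1)).shift ν ∨
        c.tgt = ((castSite x : Site P (m + 1)).shift μ).shift ν) →
      avgFun (expMeanLogSU (n := n)) Uf c = avgFun (expMeanLogSU (n := n)) (gaugeAct h U) c := by
    intro c hcs hct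
    refine T4ReflectionConeSharp.avgFun_congr₂ _ hm Uf (gaugeAct h U) c fun b hbs hbt => ?_
    have hmem : b ∈ boxBonds lo hi := by
      refine mem_boxBonds_of_ends_mem_box hN' ?_ ?_
      · refine mem_blowDown_of_blockOf_mem_box hm (corner_mem_box₂ x (blockOf b.src) ?_)
        rcases hbs with h1 | h1 <;> rw [h1]
        · exact hcs
        · exact hct
      · refine mem_blowDown_of_blockOf_mem_box hm (corner_mem_box₂ x (blockOf b.tgt) ?_)
        rcases hbt with h1 | h1 <;> rw [h1]
        · exact hcs
        · exact hct
    simp only [hUf, if_pos hmem]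
  have hsμ : ((castSite x : Site P (m + 1)).shift μ) = castSite (x + e μ) := (castSite_add_e x μ).symm
  have heqp : plaqHol (avgFun (expMeanLogSU (n := n)) Uf) ⟨castSite x, μ, ν, hμν⟩ =
      plaqHol (avgFun (expMeanLogSU (n := n)) (gaugeAct h U)) ⟨castSite x, μ, ν, hμν⟩ := by
    unfold GaugeField.plaqHol
    simp only
    rw [hbox ⟨castSite x, μ⟩ (Or.inl rfl) (Or.inr (Or.inl rfl)),
      hbox ⟨(castSite x : Site P (m + 1)).shift μ, ν⟩ (Or.inr (Or.inl rfl)) (Or.inr (Or.inr (Or.inr rfl))),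
      hbox ⟨(castSite x : Site P (m + 1)).shift ν, μ⟩ (Or.inr (Or.inr (Or.inl rfl))) (Or.inr (Or.inr (Or.inr ?_))),
      hbox ⟨castSite x, ν⟩ (Or.inl rfl) (Or.inr (Or.inr (Or.inl rfl)))]
    -- `(x + e_ν) + e_μ = (x + e_μ) + e_ν` on the torus
    show ((castSite x : Site P (m + 1)).shift ν).shift μ = ((castSite x : Site P (m + 1)).shift μ).shift ν
    rw [← castSite_add_e, ← castSite_add_e, ← castSite_add_e, ← castSite_add_e, add_right_comm]
  -- (iv) covariance and gauge invariance
  have hcov : avgFun (expMeanLogSU (n := n)) (gaugeAct h U) = gaugeAct (fun y => h (emb y)) (avgFun (expMeanLogSU (n := n)) U) :=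
    avgFun_covariant _ hm h U
  rw [heqp, hcov, dist1_plaqHol_gaugeAct_eq] at hglob
  exact hglob

/-- ★★★ **THE SAME FOR THE AVERAGING OF RECORD `avOfRecord F N K m`** (`= blockAvg expMeanLogSU`, `Node00.avOfRecord_apply`): the level-`(m+1)` plaquette of `(avOfRecord F N K m).avg U` at
`⟨castSite x, μ, ν⟩` is `< (L² + 6((d+2)L)²)·((4(d−1)(2L−1) + 1)·a)` as soon as the level-`m` plaquettes based in the blow-down box of its four corner blocks are `< a` — the letter (C1a) reads on
the dent ∕ ring of the chart's top box, where `M^{j}U = M(M^{j−1}U)` and `M^{j−1}U` is level-`(j−1)` DATA on exactly those blocks ([15] (13)).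
[cite: Balaban1985Averaging, Prop. 1 (51) pp.25–26; Balaban1987RG1, (0.4) p.253; Balaban1985Variational, (13) p.280, (7) p.278] -/
theorem dist1_plaqHol_avOfRecord_lt_of_cornerBlocks (F : T4Family) (N : ℕ) [NeZero N] (K : ℕ) {m : ℕ} (hm : m + 1 ≤ (F.P K).m + (F.P K).K)
    {a : ℝ} (ha : 0 < a) (hN : 2 * (F.P K).L < (F.P K).sitesPerDir m)
    (ht : (((((F.P K).d + 2) * (F.P K).L : ℕ) : ℝ) ^ 2 / 4) * ((4 * (((((F.P K).d - 1 : ℕ) : ℝ)) * ((2 * (F.P K).L - 1 : ℕ) : ℝ)) + 1) * a) < deltaSU (Fin N))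
    (U : GaugeField (F.P K) m (SU N)) (x : Fin (F.P K).d → ℤ) {μ ν : Fin (F.P K).d} (hμν : μ < ν)
    (hU : PlaqSmallOn (boxPlaqs (fun i => ((F.P K).L : ℤ) * x i) (fun i => ((F.P K).L : ℤ) * (x + e μ + e ν) i + (((F.P K).L : ℤ) - 1))) a U) :
    dist1 (plaqHol ((avOfRecord F N K m).avg U) ⟨castSite x, μ, ν, hμν⟩) <
      (((F.P K).L : ℝ) ^ 2 + 6 * ((((F.P K).d + 2) * (F.P K).L : ℕ) : ℝ) ^ 2) * ((4 * (((((F.P K).d - 1 : ℕ) : ℝ)) * ((2 * (F.P K).L - 1 : ℕ) : ℝ)) + 1) * a) := by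
  rw [avOfRecord_apply, blockAvg_avg]
  exact dist1_plaqHol_avgFun_lt_of_cornerBlocks hm ha hN ht U x hμν hU

end Main

end Summit.QuantumFields.YangMills.BalabanUVNodes.N07AveragedPlaquetteCornerBlocks

end
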